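import Summits.CriticalPhenomena.PercolationContinuityZ3.Theorems.PercNearOneGluingNoHeavyLowerTailThreePointLBSwitching
import Summits.CriticalPhenomena.PercolationContinuityZ3.Theorems.PercNearOneGluingNoHeavyLowerTailThreePointGammaCertificate
import HarnessLib

/-!
# `NoHeavyLowerTail` (stmt-CriticalPhenomena-4575) — THEOREM `Γ ≥ 0` (the Aas–Gladkov inequality sharpened by its exact star and triangle defects)
# on EVERY finite weighted graph, by two switchings, II: events, pointwise lemma, expectation, theorem

Support file (prover prim-cert-2 gen 9; `--supports stmt-CriticalPhenomena-4575`).  Two small event definitions (`pivEv`, `sepEv`), no named facts, no sorries.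

**Theorem** (`gamma_PrW`; source of the proof: prim-lit-2, PROOF-GAMMA.md, 2026-08-19; the inequality is prim-ineq-gen-2's `Γ` of HMAX-SPLIT.md, there
reduced to an open "Lemma B" — `CubicThreePointApex.gamma_of_lemmaB`).  Finitary weighted cube on a coordinate set `D ⊆ Sym2 V` (the SUPPORT graph) with
probabilities `p ∈ [0,1]`, apex `a` and vertices `b, c`; five cells `q = P(a|b|c)`, `u_a = P(bc|a)`, `u_b = P(ac|b)`, `u_c = P(ab|c)`, `t = P(abc)` (as in
`ThreePointLB.threePointLB_PrW`) and the two refinements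
  `n_a = P(abc ∧ b ≁ c once the pairs at a are closed)`  (the apex is PIVOTAL; event `conn a b ∩ conn a c ∩ pivEv a b c`),
  `n′_a = P(a|b|c ∧ every b–c path of the support D meets the open cluster of a)`  (event `Q ∩ sepEv D a b c`):
      `Γ := q t − u_a u_b − u_a u_c − u_b u_c − u_a (n_a + n′_a) ≥ 0`.
(`AG = qt − e₂(u) ≥ 0` is Gladkov's theorem; `Γ` subtracts its exact defect on blob-stars and blob-triangles, ineq-gen-2.)  Proof: the two-region
switchings `Φ₃ = (a→Y; b→Z)`, `Φ₄ = (b→Z; a→Y)` of `…ThreePointLBSwitchingMaps` (measure preserving, lit-2/GZ Lemma 4.2), integer potentials on their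
outputs `1, 2` only (`gcert`), the POINTWISE lemma `gcert_nonpos` (`S ≤ 0` for every triple whose first copy lies in the support; rewriting by F1/F2 of
`…ThreePointLBSwitchingClusters` into 13 atoms, ten implications from F4/F5 and two new elementary facts `cl_subset_cl_sdiff_touch` /
`sdiff_touch_subset_splice_sdiff_apex`, finite check `gamcertP_nonpos` of file I), `E[S]` by measure preservation + box factorisation (`sum_wt3W_gcert`),
three linear relations among the cells, and `gamma_identity`.  Corollary for `prodBernoulli` on the complete support: `gamma_pivotal_prodBernoulli`
(`qt − e₂(u) ≥ u_a·n_a`; on `D = all pairs` the separation refinement is void).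
-/

noncomputable section

namespace Summit.CriticalPhenomena.PercolationContinuityZ3.Theorems

namespace ThreePointGamma

open Finset Literature.Probability.Percolation Literature.Probability.Percolation.DecisionTree
open Literature.Probability.Percolation.Gladkov ThreePointLB
open scoped Classical

variable {V : Type*} [Fintype V] [DecidableEq V]

/-! ### The two refined events -/

/-- `pivEv a b c`: `b ≁ c` once the pairs at `a` are closed (with `abc`: the apex `a` is pivotal for `b–c`). [this work] -/
def pivEv (a b c : V) : Set (Finset (Sym2 V)) := {K | c ∉ cl (K \ touch {a}) b}

/-- `sepEv D a b c`: every `b–c` path of the support graph `D` meets the open cluster of `a` (no `D`-path from `b` to `c` avoiding `cl K a`). [this work] -/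
def sepEv (D : Finset (Sym2 V)) (a b c : V) : Set (Finset (Sym2 V)) := {K | c ∉ cl (D \ touch (cl K a)) b}

/-- Membership in `pivEv`. [this work] -/
@[simp] theorem mem_pivEv {a b c : V} {K : Finset (Sym2 V)} : K ∈ pivEv a b c ↔ c ∉ cl (K \ touch {a}) b := Iff.rfl

/-- Membership in `sepEv`. [this work] -/
@[simp] theorem mem_sepEv {D : Finset (Sym2 V)} {a b c : V} {K : Finset (Sym2 V)} :
    K ∈ sepEv D a b c ↔ c ∉ cl (D \ touch (cl K a)) b := Iff.rfl

/-! ### Two elementary cluster facts -/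

/-- A cluster not meeting `A = cl X a` is connected by `X`-pairs not meeting `A`. [this work] -/
theorem cl_subset_cl_sdiff_touch {X : Finset (Sym2 V)} {a b : V} (hab : b ∉ cl X a) : cl X b ⊆ cl (X \ touch (cl X a)) b := by
  intro u hu
  obtain ⟨w⟩ := mem_cl.1 hu
  refine mem_cl.2 (reachable_of_walk (C := cl X b) (fun y y' hy hyy' => mem_cl_of_adj hy hyy') ?_ w (mem_cl_self X b))
  intro y y' hy hyy'
  have hy' : y' ∈ cl X b := mem_cl_of_adj hy hyy'
  have hyA : y ∉ cl X a := fun h => hab (mem_cl_trans h (mem_cl_comm.1 hy))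
  have hy'A : y' ∉ cl X a := fun h => hab (mem_cl_trans h (mem_cl_comm.1 hy'))
  rw [adj_iff] at hyy' ⊢
  exact ⟨Finset.mem_sdiff.2 ⟨hyy'.1, by rw [mk_mem_touch, not_or]; exact ⟨hyA, hy'A⟩⟩, hyy'.2⟩

omit [Fintype V] in
/-- **(F5)** `Y ∖ touch A ⊆ (X on F | Y) ∖ touch {a}` for `F ⊆ touch A` and `a ∈ A`: a `Y`-path avoiding `A` survives and avoids the apex. [this work] -/
theorem sdiff_touch_subset_splice_sdiff_apex [Fintype V] {F X Y : Finset (Sym2 V)} {A : Finset V} {a : V} (hF : F ⊆ touch A)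
    (ha : a ∈ A) : Y \ touch A ⊆ splice F X Y \ touch {a} := by
  intro e he
  have he' := Finset.mem_sdiff.1 he
  refine Finset.mem_sdiff.2 ⟨sdiff_subset_splice hF he, fun h => he'.2 (touch_mono (Finset.singleton_subset_iff.2 ha) h)⟩

/-! ### The certificate -/

section Cert

variable (D : Finset (Sym2 V)) (a b c : V)

/-- The pointwise certificate `S(x) = λ₃(Φ₃ x) + λ₄(Φ₄ x)` of PROOF-GAMMA:
`λ₃(o) = −[o₁ ∈ Q]·[o₂: a~c] − [o₁ ∈ Q ∖ Qsa]·[o₂ ∈ Pa]`, `λ₄(o) = [o₁ ∈ Pb][o₂ ∈ Pa] + [o₁: c≁a, c≁b]·([o₂ ∈ Pa] + [o₂ ∈ Pb]) + [o₁ ∈ Tpa]·[o₂ ∈ Pa]`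
(outputs `o₁, o₂` = copies `1, 2`; cells `Q = a|b|c`, `Pa = bc|a`, `Pb = ac|b`, `Tpa = abc ∧ a pivotal`, `Qsa = Q ∧ separating`). [this work] -/
def gcert (x : Fin 3 → Finset (Sym2 V)) : ℝ :=
  - ind (box Set.univ ((conn a b)ᶜ ∩ ((conn a c)ᶜ ∩ (conn b c)ᶜ)) (conn a c)) (phi3 a b x)
  - ind (box Set.univ (((conn a b)ᶜ ∩ ((conn a c)ᶜ ∩ (conn b c)ᶜ)) ∩ (sepEv D a b c)ᶜ) (conn b c ∩ (conn a b)ᶜ)) (phi3 a b x)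
  + ind (box Set.univ (conn a c ∩ (conn a b)ᶜ) (conn b c ∩ (conn a b)ᶜ)) (phi4 a b x)
  + ind (box Set.univ ((conn a c)ᶜ ∩ (conn b c)ᶜ) (conn b c ∩ (conn a b)ᶜ)) (phi4 a b x)
  + ind (box Set.univ ((conn a c)ᶜ ∩ (conn b c)ᶜ) (conn a c ∩ (conn a b)ᶜ)) (phi4 a b x)
  + ind (box Set.univ ((conn a b ∩ conn a c) ∩ pivEv a b c) (conn b c ∩ (conn a b)ᶜ)) (phi4 a b x)

end Cert

/-! ### The pointwise lemma -/

/-- **Pointwise lemma** (PROOF-GAMMA, Lemma 2): for every graph and every triple `x = (X, Y, Z)` with `X ⊆ D`, `S(x) ≤ 0`. [this work] -/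
theorem gcert_nonpos (D : Finset (Sym2 V)) (a b c : V) (x : Fin 3 → Finset (Sym2 V)) (hx : x 0 ⊆ D) : gcert D a b c x ≤ 0 := by
  have hba : ∀ K : Finset (Sym2 V), a ∈ cl K b ↔ b ∈ cl K a := fun K => mem_cl_comm
  simp only [gcert, ind_eq_pind, mem_box, phi3_one, phi3_two, phi4_one, phi4_two, Set.mem_inter_iff, Set.mem_compl_iff,
    Set.mem_univ, true_and, mem_conn_iff_mem_cl, mem_sepEv, mem_pivEv, cl_splice_touch, mem_cl_splice_touch_root', not_not]
  simp only [mem_cl_splice_touch_iff, hba]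
  refine gamcertP_nonpos _ _ _ _ _ _ _ _ _ _ _ _ _ ?_ ?_ ?_ ?_ ?_ ?_ ?_ ?_ ?_ ?_
  · -- T3: `c ∈ A`, `c ∈ B` ⇒ `A = B`
    exact fun hac hbc => mem_cl_trans hac (mem_cl_comm.1 hbc)
  · -- transitivity in `o₃`
    exact fun hab hbc => mem_cl_trans hab hbc
  · -- transitivity in `o₂′`
    exact fun hac hbc => mem_cl_trans hac (mem_cl_comm.1 hbc)
  · -- F4: `B` stays connected in `X on touch B ∖ touch A | Z`
    exact fun hab hbc => cl_subset_cl_splice_sdiff hab (x 2) hbc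
  · -- F4: a `Z`-path avoiding `B` survives there
    exact fun h => cl_sdiff_touch_subset_cl_splice Finset.sdiff_subset a h
  · -- F4: `A` stays connected in `X on touch A ∖ touch B | Y`
    exact fun hab hac => cl_subset_cl_splice_sdiff (fun h' => hab ((hba _).1 h')) (x 1) hac
  · -- F5: a `Y`-path avoiding `A` survives there …
    exact fun h => cl_sdiff_touch_subset_cl_splice Finset.sdiff_subset b h
  · -- … and avoids the apex
    exact fun h => cl_mono (sdiff_touch_subset_splice_sdiff_apex Finset.sdiff_subset (mem_cl_self (x 0) a)) b h
  · -- separation: `c ∈ B`, `B ∩ A = ∅`, `X ⊆ D` ⇒ a support path from `b` to `c` avoids `A`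
    exact fun hab hbc => cl_mono (Finset.sdiff_subset_sdiff hx subset_rfl) b (cl_subset_cl_sdiff_touch hab hbc)
  · -- `a ∉ B` and `a ~ c` avoiding `B` ⇒ `c ∉ B`
    exact fun hab h hbc => not_mem_of_mem_cl_sdiff_touch (fun h' => hab ((hba _).1 h')) h hbc

/-! ### The expectation of the certificate -/

section Expectation

variable (p : Sym2 V → ℝ) (D : Finset (Sym2 V)) (a b c : V)

/-- `E[S]` as a signed sum of six products of `PrW`'s. [this work] -/
theorem sum_wt3W_gcert :
    ∑ x ∈ triples D, wt3W D p x * gcert D a b c x =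
      - (PrW D p Set.univ * PrW D p ((conn a b)ᶜ ∩ ((conn a c)ᶜ ∩ (conn b c)ᶜ)) * PrW D p (conn a c))
      - PrW D p Set.univ * PrW D p (((conn a b)ᶜ ∩ ((conn a c)ᶜ ∩ (conn b c)ᶜ)) ∩ (sepEv D a b c)ᶜ) * PrW D p (conn b c ∩ (conn a b)ᶜ)
      + PrW D p Set.univ * PrW D p (conn a c ∩ (conn a b)ᶜ) * PrW D p (conn b c ∩ (conn a b)ᶜ)
      + PrW D p Set.univ * PrW D p ((conn a c)ᶜ ∩ (conn b c)ᶜ) * PrW D p (conn b c ∩ (conn a b)ᶜ)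
      + PrW D p Set.univ * PrW D p ((conn a c)ᶜ ∩ (conn b c)ᶜ) * PrW D p (conn a c ∩ (conn a b)ᶜ)
      + PrW D p Set.univ * PrW D p ((conn a b ∩ conn a c) ∩ pivEv a b c) * PrW D p (conn b c ∩ (conn a b)ᶜ) := by
  have h3 : ∀ E₀ E₁ E₂ : Set (Finset (Sym2 V)),
      ∑ x ∈ triples D, wt3W D p x * ind (box E₀ E₁ E₂) (phi3 a b x) = PrW D p E₀ * PrW D p E₁ * PrW D p E₂ :=
    fun E₀ E₁ E₂ => by rw [sum_wt3W_phi3 p D a b (ind (box E₀ E₁ E₂)), sum_wt3W_ind_box]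
  have h4 : ∀ E₀ E₁ E₂ : Set (Finset (Sym2 V)),
      ∑ x ∈ triples D, wt3W D p x * ind (box E₀ E₁ E₂) (phi4 a b x) = PrW D p E₀ * PrW D p E₁ * PrW D p E₂ :=
    fun E₀ E₁ E₂ => by rw [sum_wt3W_phi4 p D a b (ind (box E₀ E₁ E₂)), sum_wt3W_ind_box]
  simp only [gcert, mul_add, mul_sub, mul_neg, Finset.sum_add_distrib, Finset.sum_sub_distrib, Finset.sum_neg_distrib, h3, h4]

end Expectation

/-! ### The theorem at the finitary level -/

section Main

variable {p : Sym2 V → ℝ} (hp0 : ∀ i, 0 ≤ p i) (hp1 : ∀ i, p i ≤ 1) (D : Finset (Sym2 V)) (a b c : V)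
include hp0 hp1

/-- **Γ ≥ 0 at the finitary level** (prim-lit-2 PROOF-GAMMA / prim-ineq-gen-2's Γ): for every finite vertex type, every support `D` with probabilities
`p ∈ [0,1]`, and all `a b c`, with `q = P(a|b|c)`, `t = P(abc)`, `u_c = P(ab|c)`, `u_b = P(ac|b)`, `u_a = P(bc|a)`, `n_a = P(abc ∧ a pivotal)`,
`n′_a = P(a|b|c ∧ V(C_a) separates b from c in D)`:  `q t − u_a u_b − u_a u_c − u_b u_c − u_a (n_a + n′_a) ≥ 0`. [this work] -/
theorem gamma_PrW :
    0 ≤ PrW D p ((conn a b)ᶜ ∩ ((conn a c)ᶜ ∩ (conn b c)ᶜ)) * PrW D p (conn a b ∩ conn a c)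
        - PrW D p (conn b c ∩ (conn a b)ᶜ) * PrW D p (conn a c ∩ (conn a b)ᶜ)
        - PrW D p (conn b c ∩ (conn a b)ᶜ) * PrW D p (conn a b ∩ (conn a c)ᶜ)
        - PrW D p (conn a c ∩ (conn a b)ᶜ) * PrW D p (conn a b ∩ (conn a c)ᶜ)
        - PrW D p (conn b c ∩ (conn a b)ᶜ) *
            (PrW D p ((conn a b ∩ conn a c) ∩ pivEv a b c) + PrW D p (((conn a b)ᶜ ∩ ((conn a c)ᶜ ∩ (conn b c)ᶜ)) ∩ sepEv D a b c)) := by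
  have t1 : ∀ K : Finset (Sym2 V), K ∈ conn a c → K ∈ conn b c → K ∈ conn a b :=
    fun K hac hbc => mem_conn.2 ((mem_conn.1 hac).trans (mem_conn.1 hbc).symm)
  have t2 : ∀ K : Finset (Sym2 V), K ∈ conn a b → K ∈ conn b c → K ∈ conn a c :=
    fun K hab hbc => mem_conn.2 ((mem_conn.1 hab).trans (mem_conn.1 hbc))
  -- R1: P(a~c) = u_b + t
  have R1 : PrW D p (conn a c) = PrW D p (conn a c ∩ (conn a b)ᶜ) + PrW D p (conn a b ∩ conn a c) := by
    rw [← PrW_union D p]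
    · refine PrW_congr_set D p fun K _ => ?_
      simp only [Set.mem_union, Set.mem_inter_iff, Set.mem_compl_iff]
      tauto
    · exact Set.disjoint_left.2 fun K h1 h2 => h1.2 h2.1
  -- R4: P(c≁a, c≁b) = q + u_c
  have R4 : PrW D p ((conn a c)ᶜ ∩ (conn b c)ᶜ) = PrW D p ((conn a b)ᶜ ∩ ((conn a c)ᶜ ∩ (conn b c)ᶜ)) +
      PrW D p (conn a b ∩ (conn a c)ᶜ) := by
    rw [← PrW_union D p]
    · refine PrW_congr_set D p fun K _ => ?_
      simp only [Set.mem_union, Set.mem_inter_iff, Set.mem_compl_iff]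
      have := t2 K; tauto
    · exact Set.disjoint_left.2 fun K h1 h2 => h1.1 h2.1
  -- Rs: P(Q ∖ Qsa) = q − n′
  have Rs : PrW D p (((conn a b)ᶜ ∩ ((conn a c)ᶜ ∩ (conn b c)ᶜ)) ∩ (sepEv D a b c)ᶜ) =
      PrW D p ((conn a b)ᶜ ∩ ((conn a c)ᶜ ∩ (conn b c)ᶜ)) - PrW D p (((conn a b)ᶜ ∩ ((conn a c)ᶜ ∩ (conn b c)ᶜ)) ∩ sepEv D a b c) := by
    have h : PrW D p ((conn a b)ᶜ ∩ ((conn a c)ᶜ ∩ (conn b c)ᶜ)) =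
        PrW D p (((conn a b)ᶜ ∩ ((conn a c)ᶜ ∩ (conn b c)ᶜ)) ∩ sepEv D a b c) +
          PrW D p (((conn a b)ᶜ ∩ ((conn a c)ᶜ ∩ (conn b c)ᶜ)) ∩ (sepEv D a b c)ᶜ) := by
      rw [← PrW_union D p]
      · refine PrW_congr_set D p fun K _ => ?_
        simp only [Set.mem_union, Set.mem_inter_iff, Set.mem_compl_iff]
        tauto
      · exact Set.disjoint_left.2 fun K h1 h2 => h2.2 h1.2
    linarith
  have hU : PrW D p (Set.univ : Set (Finset (Sym2 V))) = 1 := PrW_univ D p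
  -- E[S] ≤ 0
  have hle : ∑ x ∈ triples D, wt3W D p x * gcert D a b c x ≤ 0 :=
    Finset.sum_nonpos fun x hx =>
      mul_nonpos_of_nonneg_of_nonpos (DTree3.wt3W_nonneg D hp0 hp1 x) (gcert_nonpos D a b c x ((mem_triples.1 hx) 0))
  rw [sum_wt3W_gcert, R1, R4, Rs, hU] at hle
  have hid := gamma_identity (PrW D p ((conn a b)ᶜ ∩ ((conn a c)ᶜ ∩ (conn b c)ᶜ))) (PrW D p (conn b c ∩ (conn a b)ᶜ))
    (PrW D p (conn a c ∩ (conn a b)ᶜ)) (PrW D p (conn a b ∩ (conn a c)ᶜ)) (PrW D p (conn a b ∩ conn a c))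
    (PrW D p ((conn a b ∩ conn a c) ∩ pivEv a b c)) (PrW D p (((conn a b)ᶜ ∩ ((conn a c)ᶜ ∩ (conn b c)ᶜ)) ∩ sepEv D a b c))
  linarith

/-- **Corollary (Γ₁, prim-ineq-gen-2's `gammaOne`)**: `q t − e₂(u) ≥ u_a · n′_a`. [this work] -/
theorem gammaOne_PrW :
    PrW D p (conn b c ∩ (conn a b)ᶜ) * PrW D p (((conn a b)ᶜ ∩ ((conn a c)ᶜ ∩ (conn b c)ᶜ)) ∩ sepEv D a b c) ≤
      PrW D p ((conn a b)ᶜ ∩ ((conn a c)ᶜ ∩ (conn b c)ᶜ)) * PrW D p (conn a b ∩ conn a c)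
        - PrW D p (conn b c ∩ (conn a b)ᶜ) * PrW D p (conn a c ∩ (conn a b)ᶜ)
        - PrW D p (conn b c ∩ (conn a b)ᶜ) * PrW D p (conn a b ∩ (conn a c)ᶜ)
        - PrW D p (conn a c ∩ (conn a b)ᶜ) * PrW D p (conn a b ∩ (conn a c)ᶜ) := by
  have h := gamma_PrW hp0 hp1 D a b c
  have hn : 0 ≤ PrW D p ((conn a b ∩ conn a c) ∩ pivEv a b c) := PrW_nonneg D hp0 hp1 _
  have hu : 0 ≤ PrW D p (conn b c ∩ (conn a b)ᶜ) := PrW_nonneg D hp0 hp1 _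
  nlinarith [mul_nonneg hu hn]

end Main

end ThreePointGamma

/-! ### Corollary for `prodBernoulli w` on the complete support: `q t − e₂(u) ≥ u_a · n_a` (the pivotal refinement of Aas–Gladkov)

(Stated for `[Finite V]`, outside the explicit `[Fintype V] [DecidableEq V]` scope, as in `…ThreePointLBSwitching`.) -/

namespace ThreePointGamma

section Measure

open Finset Literature.Probability.Percolation Literature.Probability.Percolation.DecisionTree
open Literature.Probability.Percolation.Gladkov ThreePointLB
open MeasureTheory Literature.Probability.LatticeModels
open scoped Classical

variable {V : Type*} [Finite V]

/-- **Γ on the complete support, for `prodBernoulli w`**: with `t = μ(ab ∩ ac)`, `q = μ(a|b|c)`, `u_c = μ(ab|c)`, `u_b = μ(ac|b)`, `u_a = μ(bc|a)` and the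
pivotal mass `n_a = μ(ab ∧ ac ∧ b ≁ c in the configuration with the pairs at a removed)`:
`u_a · n_a ≤ q t − (u_cu_b + u_cu_a + u_bu_a)` — Gladkov's `AG ≥ 0` sharpened by the triangle defect (prim-ineq-gen-2 / prim-lit-2 PROOF-GAMMA; on the
complete support the star defect `n′_a` is dropped, being `≥ 0`). [this work] -/
theorem gamma_pivotal_prodBernoulli (w : Sym2 V → unitInterval) (a b c : V) :
    (prodBernoulli w).real (openConn b c ∩ (openConn a b)ᶜ) *
        (prodBernoulli w).real {ω : BondConfig V | ω ∈ openConn a b ∧ ω ∈ openConn a c ∧ {e | e ∈ ω ∧ a ∉ e} ∉ openConn b c} ≤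
      (prodBernoulli w).real ((openConn a b)ᶜ ∩ (openConn a c)ᶜ ∩ (openConn b c)ᶜ) * (prodBernoulli w).real (openConn a b ∩ openConn a c) -
        ((prodBernoulli w).real (openConn a b ∩ (openConn a c)ᶜ) * (prodBernoulli w).real (openConn a c ∩ (openConn a b)ᶜ) +
          (prodBernoulli w).real (openConn a b ∩ (openConn a c)ᶜ) * (prodBernoulli w).real (openConn b c ∩ (openConn a b)ᶜ) +
          (prodBernoulli w).real (openConn a c ∩ (openConn a b)ᶜ) * (prodBernoulli w).real (openConn b c ∩ (openConn a b)ᶜ)) := by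
  obtain ⟨_instV⟩ := nonempty_fintype V
  have hp0 : ∀ e, 0 ≤ (w e : ℝ) := fun e => (w e).2.1
  have hp1 : ∀ e, (w e : ℝ) ≤ 1 := fun e => (w e).2.2
  have key := gamma_PrW (p := fun e => (w e : ℝ)) hp0 hp1 Finset.univ a b c
  have hn' : 0 ≤ PrW Finset.univ (fun e => (w e : ℝ))
      (((conn a b)ᶜ ∩ ((conn a c)ᶜ ∩ (conn b c)ᶜ)) ∩ sepEv (Finset.univ : Finset (Sym2 V)) a b c) := PrW_nonneg _ hp0 hp1 _
  have hua : 0 ≤ PrW Finset.univ (fun e => (w e : ℝ)) (conn b c ∩ (conn a b)ᶜ) := PrW_nonneg _ hp0 hp1 _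
  have hco : ∀ (S : Finset (Sym2 V)) (u v : V),
      (↑S : Set (Sym2 V)) ∈ openConn u v ↔ (openGraph (↑S : Set (Sym2 V))).Reachable u v := fun _ _ _ => Iff.rfl
  have hcoe : ∀ S : Finset (Sym2 V), (↑(S \ touch {a}) : Set (Sym2 V)) = {e | e ∈ (↑S : Set (Sym2 V)) ∧ a ∉ e} := by
    intro S; ext e
    simp only [Finset.coe_sdiff, Set.mem_sdiff, Finset.mem_coe, mem_touch, Finset.mem_singleton, exists_eq_left, Set.mem_setOf_eq]
  have e1 : (prodBernoulli w).real (openConn a b ∩ openConn a c) = PrW Finset.univ (fun e => (w e : ℝ)) (conn a b ∩ conn a c) :=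
    prodBernoulli_real_eq_PrW_univ w fun S => by simp only [Set.mem_inter_iff, mem_conn, hco]
  have e2 : (prodBernoulli w).real ((openConn a b)ᶜ ∩ (openConn a c)ᶜ ∩ (openConn b c)ᶜ) =
      PrW Finset.univ (fun e => (w e : ℝ)) ((conn a b)ᶜ ∩ ((conn a c)ᶜ ∩ (conn b c)ᶜ)) :=
    prodBernoulli_real_eq_PrW_univ w fun S => by simp only [Set.mem_inter_iff, Set.mem_compl_iff, mem_conn, hco, and_assoc]
  have e3 : (prodBernoulli w).real (openConn a b ∩ (openConn a c)ᶜ) = PrW Finset.univ (fun e => (w e : ℝ)) (conn a b ∩ (conn a c)ᶜ) :=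
    prodBernoulli_real_eq_PrW_univ w fun S => by simp only [Set.mem_inter_iff, Set.mem_compl_iff, mem_conn, hco]
  have e4 : (prodBernoulli w).real (openConn a c ∩ (openConn a b)ᶜ) = PrW Finset.univ (fun e => (w e : ℝ)) (conn a c ∩ (conn a b)ᶜ) :=
    prodBernoulli_real_eq_PrW_univ w fun S => by simp only [Set.mem_inter_iff, Set.mem_compl_iff, mem_conn, hco]
  have e5 : (prodBernoulli w).real (openConn b c ∩ (openConn a b)ᶜ) = PrW Finset.univ (fun e => (w e : ℝ)) (conn b c ∩ (conn a b)ᶜ) :=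
    prodBernoulli_real_eq_PrW_univ w fun S => by simp only [Set.mem_inter_iff, Set.mem_compl_iff, mem_conn, hco]
  have e6 : (prodBernoulli w).real {ω : BondConfig V | ω ∈ openConn a b ∧ ω ∈ openConn a c ∧ {e | e ∈ ω ∧ a ∉ e} ∉ openConn b c} =
      PrW Finset.univ (fun e => (w e : ℝ)) ((conn a b ∩ conn a c) ∩ pivEv a b c) :=
    prodBernoulli_real_eq_PrW_univ w fun S => by
      simp only [Set.mem_inter_iff, mem_conn, mem_pivEv, mem_cl, Set.mem_setOf_eq, hco, ← hcoe, and_assoc]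
  rw [e1, e2, e3, e4, e5, e6]
  nlinarith [mul_nonneg hua hn']

end Measure

end ThreePointGamma

end Summit.CriticalPhenomena.PercolationContinuityZ3.Theorems

end
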